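/-
Copyright (c) 2026 the pub-hodgecm-mathlib formalisation cell (harness21).  Prover seat hodgecm-mathlib-F0P3a-p01 (g37), FLOOR 0, SUPPORTS-ONLY on h413; β-BOARD v1 R10
(assembler): the `hRest` glue, part 3 — the per-tower DISPATCHER of the rest shapes of tower 3 onto the row heads (off-locus zero, foot line, R6).  2026-09-04.
-/
import Summits.HodgeConjecture.HodgeConjecture.Theorems.F0P3cDyRamLabelledOddGluedOffFootHighG3  -- ★ p861598 (this seat): A′ tower 3; brings the (β) table vocabulary (strata, labelled odd count, torus)
import Summits.HodgeConjecture.HodgeConjecture.Theorems.F0P3cDyRamStageOneBDefs               -- ★ DEFS №5: `mcOfRecord`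
import Summits.HodgeConjecture.HodgeConjecture.Theorems.F0P3cDyRamElementDatumParity          -- ★: `isoceles_of_isElementDatum`, `depth_mod_two_eq_of_isElementDatum`
import HarnessLib

/-!
# Crux `H413`, LH4 «(D-RAM) FOUR-FRAME» road, STAGE 1b (β) — THE `hRest` GLUE, PART 3: THE TOWER-3 DISPATCHER — every NON-TUBE glued stratum `![2ρ+s, 2ρ+s, 2ρ]` gets its
# value from exactly one of {the off-locus zero (LH4-p11 (g9) (B-Z1)), the foot line (R7₃), R6₃}, giving the socket letter `VG 2 ρ s = [2ρ+ℓ₀ = n₂ ∧ n₃ ≠ n₂+s]·κ ρ s`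

Cell `hodgecm-mathlib` (D-0151), FLOOR 0, crux item H413 = `stmt-HodgeConjecture-24833`, route `HCCMUnconditional`; squad F0∕P3c∕LH4.  THEOREMS ONLY (no `def`, no instance, no
notation, no `sorry`, default heartbeats); lane `--supports stmt-HodgeConjecture-24833 --as helper` (count-neutral; pays NO row).

THE DISPATCH (tower-3 twin of ★ p861555 `…RestDispatchG1.restValue_G1_of_rows` and ★ p861654 `…RestDispatchG2.restValue_G2_of_rows`; tower 3 is NOT a coordinate-swap image of
tower 1 — `T = diag(α, β, 1)` — so its rows are read directly).  Letters of tower 3: strata `![2ρ+s, 2ρ+s, 2ρ]`, read `2ρ+s+ℓ₀ = n₃`, cap `2ρ+2+ℓ₀ ≤ min n₁ n₂`, foot `n₃ = n₂ + s`,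
κ-locus `2ρ+ℓ₀ = n₂` (`ℓ₀ = d % 2`).  At one datum, for `ρ, s ≥ 1`, `2 ∣ s` and NOT (read ∧ cap): (1) ON the foot ⇒ the foot line R7₃ (`hF`) ⇒ 0; (2) off the foot ON the
κ-locus ⇒ R6₃ (`hR6`, value `κ ρ s`); (3) off the foot, off the κ-locus ⇒ LH4-p11 (g9)'s off-locus zero (`hZ`, the shape of `…LabelledOddOffLocusShellG3.finsum_stratum_G3_shell_eq_
zero_offLocus`: neither the READ branch `2ρ+s+ℓ₀ = n₃ ∧ 2ρ+ℓ₀+1 ≤ n₂` nor the κ branch `2ρ+ℓ₀ = n₂ ∧ 2ρ+s+ℓ₀ < n₃`) ⇒ 0 — the read branch is excluded because read ∧ `2ρ+ℓ₀+1 ≤ n₂`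
forces cap (parity `n₂ ≡ ℓ₀ (mod 2)`, `s ≥ 2`, and the isosceles rule «the two smaller depths are equal»).  The three row statements enter as HYPOTHESES in their announced shapes
(R6₃ with a free closed form `κ`), so this file is independent of R6's q-exponent and of how the foot line is cut by its owner; at assembly the ★ names are passed in.
HONEST LABEL.  Count-neutral dispatcher; the off-locus zero is LH4-p11 (g9)'s (B-Z1) (GREEN, filing), the foot line and R6₃ are hypotheses here; `hRest`, (β) OPEN; `HC_CM` is
proved only modulo the 7 printed citations (2 remaining named inputs: hLiu418 = `stmt-HodgeConjecture-24832`, h413 = `stmt-HodgeConjecture-24833`) until rung 0 closes.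

## References
* [Kottwitz1986BaseChangeUnits] R. E. Kottwitz, *Base change for unit elements of Hecke algebras*, Compositio Math. 60 (1986), §1 pp. 240–241 (lattice counts by strata).
* [Rogawski1990] J. D. Rogawski, *Automorphic Representations of Unitary Groups in Three Variables*, Ann. of Math. Stud. 123 (1990), §4.9 Prop. 4.9.1 (a)(b) p. 55.
-/

set_option autoImplicit false

noncomputable section

namespace Summit.HodgeConjecture.HodgeConjecture.Cruxes.H413.F0P3cDyRamLabelledOddRestDispatchG3

open Literature.NumberTheory.Automorphic Literature.NumberTheory.Automorphic.HermitianLattice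
open Literature.NumberTheory.Automorphic.UnitaryLatticeTree Literature.NumberTheory.Automorphic.UnitaryThreeFourFrame
open Summit.HodgeConjecture.HodgeConjecture.Cruxes.H413.F0P3cDyRamFourFramePieces
open Summit.HodgeConjecture.HodgeConjecture.Cruxes.H413.F0P3cDyRamFourFrameCensusDefs
open Summit.HodgeConjecture.HodgeConjecture.Cruxes.H413.F0P3cDyRamStageOneBDefs (mcOfRecord)
open Summit.HodgeConjecture.HodgeConjecture.Cruxes.H413.F0P3cDyRamDiagonalTorusDefs
open Summit.HodgeConjecture.HodgeConjecture.Cruxes.H413.F0P3cDyRamDiagonalStrataDefs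
open Summit.HodgeConjecture.HodgeConjecture.Cruxes.H413.F0P3cDyRamLabelledOddCountDefs
open Summit.HodgeConjecture.HodgeConjecture.Cruxes.H413.F0P3cDyRamElementDatumParity (isoceles_of_isElementDatum depth_mod_two_eq_of_isElementDatum)
open scoped Valued WithZero Matrix MatrixGroups

variable {K : Type} [Field K] [Valued K ℤᵐ⁰] {σ : K →+* K} {ϖ : K} {d t : ℕ} {α β : K} {N₀ n₁ n₂ n₃ : ℕ}

/-- **THE TOWER-3 REST DISPATCHER.**  At a ramified datum with an element datum at `N₀ ≥ d`, any `T`: given the three row statements of the β-BOARD for tower 3 — the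
off-locus zero `hZ` (off the foot, off the READ branch and off the κ branch ⇒ 0; LH4-p11 (g9) (B-Z1)), the foot line `hF` (`n₃ = n₂ + s` ⇒ 0; R7₃) and R6₃ (`hR6`: κ-locus
`2ρ+ℓ₀ = n₂` off the foot ⇒ `κ ρ s i`) — every NON-TUBE glued stratum `![2ρ+s, 2ρ+s, 2ρ]` (`ρ, s ≥ 1`, `2 ∣ s`, `¬(2ρ+s+ℓ₀ = n₃ ∧ 2ρ+2+ℓ₀ ≤ min n₁ n₂)`) carries the
clean-shell labelled-odd table `if 2ρ + d%2 = n₂ ∧ n₃ ≠ n₂ + s then κ ρ s i else 0` — the socket letter `VG 2` of ★ `…OddLabelledRestReindex.sum_box_restShape_eq_of_rows`.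
[cite: Kottwitz1986BaseChangeUnits, §1 pp. 240–241] [cite: Rogawski1990, §4.9 Prop. 4.9.1 (a)(b) p. 55] -/
theorem restValue_G3_of_rows (hD : IsRamifiedQuadraticDatum σ ϖ d t)
    (hE : IsElementDatum σ ϖ N₀ α β n₁ n₂ n₃) (hdN₀ : d ≤ N₀) (T : GL (Fin 3) K) (κ : ℕ → ℕ → Fin 3 → ℚ)
    (hZ : ∀ (ρ s : ℕ), 1 ≤ ρ → 1 ≤ s → n₃ ≠ n₂ + s → ¬ (2 * ρ + s + d % 2 = n₃ ∧ 2 * ρ + d % 2 + 1 ≤ n₂) →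
      ¬ (2 * ρ + d % 2 = n₂ ∧ 2 * ρ + s + d % 2 < n₃) → ∀ i : Fin 3,
      ∑ᶠ M ∈ {M : Submodule 𝒪[K] (Fin 3 → K) | M ∈ stratum σ ϖ T ![2 * ρ + s, 2 * ρ + s, 2 * ρ] ∧
          (LatticeInLevel ϖ (d % 2) (Matrix.diagonal ![α - 1, β - 1, 0]) M ∧ ¬ LatticeInLevel ϖ (d % 2 + 1) (Matrix.diagonal ![α - 1, β - 1, 0]) M ∧
            LatticeInLevel ϖ (mcOfRecord d) (Matrix.diagonal ![(α - 1) * (α - 1), (β - 1) * (β - 1), 0]) M)},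
        (labelledOddCount σ ϖ 0 i (valueClassLabel σ ϖ (α - 1) (β - 1) (mstarOfRecord d) d) M : ℚ) /
          ((((unitStabilizer M).map (unitNormMap σ 3)).relIndex (fixedUnitTorus σ 3) : ℕ) : ℚ) = 0)
    (hF : ∀ (ρ s : ℕ), 1 ≤ ρ → 1 ≤ s → 2 ∣ s → n₃ = n₂ + s → ∀ i : Fin 3,
      ∑ᶠ M ∈ {M : Submodule 𝒪[K] (Fin 3 → K) | M ∈ stratum σ ϖ T ![2 * ρ + s, 2 * ρ + s, 2 * ρ] ∧
          (LatticeInLevel ϖ (d % 2) (Matrix.diagonal ![α - 1, β - 1, 0]) M ∧ ¬ LatticeInLevel ϖ (d % 2 + 1) (Matrix.diagonal ![α - 1, β - 1, 0]) M ∧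
            LatticeInLevel ϖ (mcOfRecord d) (Matrix.diagonal ![(α - 1) * (α - 1), (β - 1) * (β - 1), 0]) M)},
        (labelledOddCount σ ϖ 0 i (valueClassLabel σ ϖ (α - 1) (β - 1) (mstarOfRecord d) d) M : ℚ) /
          ((((unitStabilizer M).map (unitNormMap σ 3)).relIndex (fixedUnitTorus σ 3) : ℕ) : ℚ) = 0)
    (hR6 : ∀ (ρ s : ℕ), 1 ≤ ρ → 1 ≤ s → 2 ∣ s → 2 * ρ + d % 2 = n₂ → n₃ ≠ n₂ + s → ∀ i : Fin 3,
      ∑ᶠ M ∈ {M : Submodule 𝒪[K] (Fin 3 → K) | M ∈ stratum σ ϖ T ![2 * ρ + s, 2 * ρ + s, 2 * ρ] ∧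
          (LatticeInLevel ϖ (d % 2) (Matrix.diagonal ![α - 1, β - 1, 0]) M ∧ ¬ LatticeInLevel ϖ (d % 2 + 1) (Matrix.diagonal ![α - 1, β - 1, 0]) M ∧
            LatticeInLevel ϖ (mcOfRecord d) (Matrix.diagonal ![(α - 1) * (α - 1), (β - 1) * (β - 1), 0]) M)},
        (labelledOddCount σ ϖ 0 i (valueClassLabel σ ϖ (α - 1) (β - 1) (mstarOfRecord d) d) M : ℚ) /
          ((((unitStabilizer M).map (unitNormMap σ 3)).relIndex (fixedUnitTorus σ 3) : ℕ) : ℚ) = κ ρ s i)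
    (ρ s : ℕ) (hρ : 1 ≤ ρ) (hs : 1 ≤ s) (h2s : 2 ∣ s) (hnt : ¬ (2 * ρ + s + d % 2 = n₃ ∧ 2 * ρ + 2 + d % 2 ≤ min n₁ n₂)) (i : Fin 3) :
    ∑ᶠ M ∈ {M : Submodule 𝒪[K] (Fin 3 → K) | M ∈ stratum σ ϖ T ![2 * ρ + s, 2 * ρ + s, 2 * ρ] ∧
        (LatticeInLevel ϖ (d % 2) (Matrix.diagonal ![α - 1, β - 1, 0]) M ∧ ¬ LatticeInLevel ϖ (d % 2 + 1) (Matrix.diagonal ![α - 1, β - 1, 0]) M ∧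
          LatticeInLevel ϖ (mcOfRecord d) (Matrix.diagonal ![(α - 1) * (α - 1), (β - 1) * (β - 1), 0]) M)},
      (labelledOddCount σ ϖ 0 i (valueClassLabel σ ϖ (α - 1) (β - 1) (mstarOfRecord d) d) M : ℚ) /
        ((((unitStabilizer M).map (unitNormMap σ 3)).relIndex (fixedUnitTorus σ 3) : ℕ) : ℚ) =
      if 2 * ρ + d % 2 = n₂ ∧ n₃ ≠ n₂ + s then κ ρ s i else 0 := by
  -- letters of the datum
  have hiso := isoceles_of_isElementDatum hD hE
  obtain ⟨-, hp2, -⟩ := depth_mod_two_eq_of_isElementDatum hD hE hdN₀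
  by_cases hfoot : n₃ = n₂ + s
  · -- (1) on the foot: the foot line
    rw [hF ρ s hρ hs h2s hfoot i, if_neg]
    exact fun h => h.2 hfoot
  · by_cases hκ : 2 * ρ + d % 2 = n₂
    · -- (2) off the foot at the κ-locus: R6₃
      rw [hR6 ρ s hρ hs h2s hκ hfoot i, if_pos ⟨hκ, hfoot⟩]
    · -- (3) off the foot, off the κ-locus: the off-locus zero (the READ branch would force cap)
      rw [if_neg (fun h => hκ h.1)]
      refine hZ ρ s hρ hs hfoot ?_ (fun h => hκ h.1) i
      rintro ⟨hread, hle⟩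
      apply hnt
      refine ⟨hread, ?_⟩
      obtain ⟨s', rfl⟩ := h2s
      rcases hiso with ⟨h12, h13⟩ | ⟨h13, h12⟩ | ⟨h23, h21⟩
      · rw [le_min_iff]; constructor <;> omega
      · rw [le_min_iff]; constructor <;> omega
      · rw [le_min_iff]; constructor <;> omega

end Summit.HodgeConjecture.HodgeConjecture.Cruxes.H413.F0P3cDyRamLabelledOddRestDispatchG3

end
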